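import Summits.CriticalPhenomena.CardyFormulaZ2.Theses.CardySelfRefinement
import Literature.Probability.Percolation.InterfaceScalingLimitDiscretised
import Literature.Probability.RandomPlanarGeometry.LocalMartingaleProofs
import HarnessLib

/-!
# `SymmetryUpgradeR` (stmt-CriticalPhenomena-17239) follows from Smirnov's Conjecture 4 for bond-ℤ²

Structural sandwich for the planners (line `SketchIdeatorTwo`, lead's clarifier). The crux
`SymmetryUpgradeR` is IMPLIED by the standard open conjecture
`Literature.Probability.Percolation.SLE6LimitZ2AllDiscretisations` (Smirnov, ICM 2006, §2.3 Conj. 4 at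
`q = 1`: the bond-ℤ² exploration interface of every admissibly discretised Dobrushin domain converges in
law to chordal SLE₆ along the full mesh filter): a family pinned by clause (iv) along one mesh sequence
is, on each admissibly discretised domain, the weak limit of laws that converge to THE SLE₆ law, hence is
that law (uniqueness of weak limits of finite Borel measures on the metric space `CurveClass ℂ`). The
typed axioms (i), (ii) are not used. Conversely the route `CardySelfRefinement` derives the conjecture's
consequence `CardyFormulaZ2` from the crux (items SubseqUpgrade, InterfaceToCardy), and the refuter's
`Negative.symmetryUpgradeR_false_without_clauseIV` shows (iv) is load-bearing; together: the crux is
true if conformal invariance of critical bond-ℤ² percolation holds, and no easier than identifying the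
pinned limit — its open content is exactly the open problem (the line's stub `stub_conformalFront`).
-/

noncomputable section

namespace Summit.CriticalPhenomena.CardyFormulaZ2.Theorems.SymmetryUpgradeR.SwallowingSkeleton

open MeasureTheory Filter Set Topology
open Literature.Probability.RandomPlanarGeometry Literature.Probability.LatticeModels
  Literature.Probability.Percolation Literature.Probability.Process

/-- **Smirnov's Conjecture 4 (bond-ℤ², all admissible discretisations) implies `SymmetryUpgradeR`.**
If the bond-ℤ² interfaces converge in law to chordal SLE₆ along `δ → 0⁺` for every Dobrushin domain and
every admissible discretisation family, then every chordal family satisfying clause (iv) (sequential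
limit of the same interfaces along one mesh sequence `δₙ → 0⁺`) is the chordal SLE₆ law on every
admissibly discretised domain: both are limits of the same real sequences `∫ f dLaw(γ_{δₙ})`, and finite
Borel measures on `CurveClass ℂ` are determined by their bounded continuous integrals. Hypotheses (i)
(beyond `P D` being a probability measure), (ii), (iii) of the crux are idle here. [folklore] -/
theorem symmetryUpgradeR_of_sle6LimitZ2AllDiscretisations : Literature.Probability.Percolation.SLE6LimitZ2AllDiscretisations → Summit.CriticalPhenomena.CardyFormulaZ2.Theses.CardySelfRefinement.SymmetryUpgradeR := by
  intro h P hP _hnt _hmeas hconv D E hE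
  obtain ⟨δs, hpos, hδ, hlim⟩ := hconv
  obtain ⟨Γ, hΓ, -, hlaw⟩ := h D E hE
  haveI : IsProbabilityMeasure (P D) := (hP.isChordal D).1
  have hΓm : AEMeasurable Γ preWienerMeasure := hΓ.1
  haveI : IsProbabilityMeasure preWienerMeasure := isProbabilityMeasure_preWienerMeasure'
  haveI : IsProbabilityMeasure (preWienerMeasure.map Γ) := Measure.isProbabilityMeasure_map hΓm
  refine ⟨Γ, hΓ, ?_⟩
  have hseq : Tendsto δs atTop (𝓝[>] (0 : ℝ)) :=
    tendsto_nhdsWithin_iff.2 ⟨hδ, Eventually.of_forall fun n => hpos n⟩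
  refine ext_of_forall_integral_eq_of_IsFiniteMeasure fun f => ?_
  have h1 := hlim D E hE f
  have h2 : Tendsto (fun n => ∫ ω, f (Interface.bondInterfaceIn D (E (δs n)) ω) ∂(bondPercolation (zdGraph 2) half))
      atTop (𝓝 (∫ ω, f (Γ ω) ∂preWienerMeasure)) := (hlaw f).comp hseq
  rw [tendsto_nhds_unique h1 h2, integral_map hΓm f.continuous.aestronglyMeasurable]

end Summit.CriticalPhenomena.CardyFormulaZ2.Theorems.SymmetryUpgradeR.SwallowingSkeleton

end
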